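import Literature.MathematicalPhysics.QuantumFieldTheory.Balaban1983to89.B15Prop1Thm1RowsOfExistsUnique
import Literature.MathematicalPhysics.QuantumFieldTheory.Balaban1983to89.CentreTwist

/-!
# `Balaban1983to89.B15Prop1Thm1LetterLengthZero` — [Balaban1985Variational] = «[15]», Thm 1 p. 279, (2)–(6) p. 278; [Balaban1988Convergent] = «[III]», (2.1)–(2.2) pp. 254–255,
# (2.18) p. 257; [tHooft1979Flux] §2: THE CLOSED EXISTENCE ∕ UNIQUENESS LETTER `h15EUT` OF THE (J0′) ROAD, QUANTIFIED OVER ALL LENGTHS `k' ≤ m + K` INCLUDING `k' = 0`,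
# IS UNSATISFIABLE — kernel certificate (typing-strength finding of the lane on its own letter; the repair is the `0 < k'` edition)

Honest framing: statement-level skeleton of published theorems with citation tags; proofs where landed; nothing here is a claim about the Yang–Mills mass gap.  Cell `pub-ymgap`
(HUMAN RULINGS D-0062 ∕ D-0149), lane `pub-ymgap-dag-n12-c` g29 (R134 seat (a), N12 = [B15], s1); count-neutral; `--kind proof --supports` K1⁹ `stmt-QuantumFields-27364`; N12 NOT
discharged; finite 𝕋⁴ at fixed ε; nothing continuum ∕ ℝ⁴ ∕ OS ∕ mass-gap ∕ Clay.  THEOREMS ONLY (0 `def`, 0 `instance`, 0 `sorry`).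

THE FINDING (A2 species, self-reported).  `B15Prop1Thm1RowsOfExistsUnique.thm1Rows_atZ_of_thm1TorusClass_existsUnique` (p729581 §3) — and, verbatim, the knit heads
`Summits/…/BalabanUVNodesN12MinimiserFamilyKnitRowThm1Letters(OnZ)(OfRecord)` — display the existence ∕ uniqueness half of [15] Theorem 1 as ONE closed letter `h15EUT` quantified
`∀ k' ≤ m + K` over r11's (2.18) index type `B14Eq218Concrete.Seq D k'`.  In print the length-0 problem is TRIVIAL (`𝔅₀ = {Λ₀ = Ω₀}`: (3) at `j = 0` pins `U = V` on all of `Ω₀`; Thm 1's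
induction starts at `k = 1`); the tree's index type at LENGTH ZERO is the EMPTY sequence (`Seq.Ω_off`: `Ω_j = ∅` off the window `1 ≤ j ≤ k'`) and r12's `gammaRegion Ω 0 0` takes its
`i = k` branch (`Γ_k = Ω_k`, here `Ω 0 = ∅`) before its `i = 0` branch (`Γ₀ = (Ω₁)ᶜ = T`), so the tree's determining set at length 0 is EMPTY where print's is EVERYTHING, and at `k' = 0` the
letter speaks of the UNCONSTRAINED minimisation of the Wilson action over the `ε₀`-small class of the whole torus: the flat configuration `1` and its 't Hooft CENTRE TWIST `ctwist (−1) e_0 0 1`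
([tHooft1979Flux] §2; tree `CentreTwist`) are both flat, both in the class, both minimisers (`A ≥ 0 = A(flat)`), and NOT gauge-equivalent — the holonomy along the straight closed walk winding
once around the `e_0`-period is `1` for every gauge transform of `1` (`holAt_gaugeAct_walk`, closed walk) and `−1` for the twist (winding law `holAt_ctwist_walk_of_netDisp_eq_mul`).  Hence the
uniqueness clause fails at `k' = 0` and the closed letter is FALSE whenever its numerics are print's (`0 < a₀`, `0 < a₁`, `0 < M₁`, `M₁ ∣ 2L^{m+K}`) — in particular inside every application
of §3 (there `a₁ ≥ (c_E+1)ε > 0`, `M₁ ≥ 2`, `M₁ ∣ Lᵏ M₁ ∣ 2L^{m+K}`, and `a₀ > 0` as soon as `B₃ ≥ 0`).  The (8)-letter `h15T` (K0⁷'s shape) is NOT affected (flat minimisers are regular).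
REPAIR (sibling module `B15Prop1Thm1RowsOfExistsUniquePos`): the same letter at lengths `0 < k'` only — where the tree's `Γ₀ = (Ω₁)ᶜ` agrees with print — serves §3's conclusion by §3's proof
verbatim (it calls the letter at `k' = k i ≥ 1`); consumers re-key one binder.

CONTENTS.  §1 flat configurations (plaquettes, action, co-divergence, class, minimality with empty determining set); §2 the winding obstruction (`holAt` of a gauge transform of `1` along a
closed walk is `1`; of the centre twist along the `e_0`-cycle is the centre element); §3 ★★★ `not_thm1TorusClassEU_allLengths` (the letter of §3 of the parent is unsatisfiable) and
★ `not_thm1RecordEU_allLengths` (so is its NODE-00 house-shape twin of the parent's §4, by the parent's own reduction); §4 `side_zero_dvd_side`, ★ `not_thm1TorusClassEU_allLengths_of_dvd`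
(the divisibility row of ANY length serves), ★★ `not_thm1TorusClassEU_allLengths_at_binders` (inside the parent §3's own numeric binders — one instance, `0 ≤ B₃` — the letter is
contradictory: every application of the parent's §3 and of the three knit heads is ex falso as typed).

HONEST SCOPE.  A typing-strength certificate about the lane's OWN displayed letter at a length print does not have; [15] Theorem 1 (k ≥ 1) is neither asserted nor refuted; count-neutral;
N12 NOT discharged; the YM mass gap (Clay) is NOT proved by any of this — R4 closes only the conditional finite-𝕋⁴ rung `BalabanLadder.UV`.
-/

noncomputable section

open Set

namespace Literature.MathematicalPhysics.QuantumFieldTheory.Balaban1983to89.B15Prop1Thm1LetterLengthZero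

open T4Continuum B15DeterminingSets GaugeField B8Eq17ClassAkV1 BlockAveraging
open B14.Eq213MaximalDomains (side)
open T4CubeChartGnomonic (SU2)
open B16Sect1Backgrounds (toMS)
open scoped Matrix.Norms.L2Operator

/-! ## §1  Flat configurations: plaquettes, action, co-divergence, class membership, minimality under the empty determining set -/

section Flat

variable {P : Params} {j : ℕ} {G : Type*} [GaugeGroup G]

/-- Every bond variable of the trivial configuration is `1`. [folklore] -/
private theorem one_apply (b : PBond P j) : (1 : GaugeField P j G) b = 1 := rfl

/-- The trivial configuration is flat. [folklore] -/
private theorem plaqHol_one (p : Plaq P j) : plaqHol (1 : GaugeField P j G) p = 1 := by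
  simp [plaqHol]

/-- The centre twist of the trivial configuration is flat ('t Hooft: plaquettes do not see a central twist). [cite: tHooft1979Flux, §2] -/
theorem plaqHol_ctwist_one {z : G} (hz : ∀ g : G, z * g = g * z) (μ : Fin P.d) (s : ZMod (P.sitesPerDir j)) (p : Plaq P j) :
    plaqHol ((1 : GaugeField P j G).ctwist z μ s) p = 1 := by
  rw [plaqHol_ctwist hz, plaqHol_one]

/-- A flat configuration has zero Wilson action. [cite: Balaban1987RG1, (0.2) p.252 (bookkeeping)] -/
theorem wilsonAction4_eq_zero_of_flat {U : GaugeField P j G} (hU : ∀ p, plaqHol U p = 1) : wilsonAction4 U = 0 := by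
  simp [wilsonAction4, wilsonAction, hU, GaugeGroup.reTr_one]

/-- A flat configuration minimises the Wilson action outright. [cite: Balaban1987RG1, (0.2) p.252 (bookkeeping)] -/
theorem wilsonAction4_le_of_flat {U : GaugeField P j G} (hU : ∀ p, plaqHol U p = 1) (U' : GaugeField P j G) : wilsonAction4 U ≤ wilsonAction4 U' := by
  rw [wilsonAction4_eq_zero_of_flat hU]; exact wilsonAction4_nonneg U'

/-- A flat configuration is `t`-plaquette-small on any plaquette set, for every `t > 0`. [cite: Balaban1985RegularSpaces, (1.7) p.77 (bookkeeping)] -/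
theorem plaqSmallOn_of_flat {U : GaugeField P j G} (hU : ∀ p, plaqHol U p = 1) (S : Set (Plaq P j)) {t : ℝ} (ht : 0 < t) : PlaqSmallOn S t U := by
  intro p _
  rw [hU, GaugeGroup.dist1_one]; exact ht

/-- Parallel transport of the trivial configuration along any step sequence is `1`. [folklore] -/
private theorem holAt_one (γ : List (LStep P j)) : T4Continuum.holAt (1 : GaugeField P j G) γ = 1 := by
  induction γ with
  | nil => simp [T4Continuum.holAt]
  | cons s γ ih =>
    rw [holAt_cons, ih, one_apply]
    split_ifs <;> simp

end Flat

section FlatSU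

variable {P : Params} {N : ℕ} [NeZero N]

/-- The embedded plaquette matrix of a flat `SU(N)` configuration is the identity. [cite: Balaban1985RegularSpaces, (1.2) p.76 (bookkeeping)] -/
theorem plaqMat_of_flat {U : GaugeField P 0 (Node00.SU N)} (hU : ∀ p, plaqHol U p = 1) (x : Site P 0) (μ ν : Fin P.d) (h : μ < ν) :
    Node00.Sect2.plaqMat U x μ ν h = 1 := by
  simp [Node00.Sect2.plaqMat, hU]

omit [NeZero N] in
/-- `ι(g⁻¹)·ι(g) = 1` in `M_N(ℂ)`. [folklore] -/
private theorem coe_ιSU_inv_mul (g : Node00.SU N) : ((Node00.ιSU N g⁻¹ : (Node00.MatA N)ˣ) : Node00.MatA N) * ((Node00.ιSU N g : (Node00.MatA N)ˣ) : Node00.MatA N) = 1 := by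
  rw [← Units.val_mul, ← map_mul, inv_mul_cancel, map_one, Units.val_one]

/-- The covariant co-divergence of the plaquette field of a FLAT `SU(N)` configuration vanishes at every bond (`R(U)·1 − 1 = 0` termwise). [cite: Balaban1985RegularSpaces, (1.1)–(1.2) p.76] -/
theorem coDivSum_of_flat {U : GaugeField P 0 (Node00.SU N)} (hU : ∀ p, plaqHol U p = 1) (x : Site P 0) (μ : Fin P.d) :
    Node00.Sect2.coDivSum U x μ = 0 := by
  have hterm : ∀ (y : Site P 0) (ν α β : Fin P.d) (h : α < β), Node00.Sect2.coDivTerm U y ν α β h = 0 := by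
    intro y ν α β h
    simp only [Node00.Sect2.coDivTerm, plaqMat_of_flat hU, mul_one, coe_ιSU_inv_mul, sub_self]
  simp [Node00.Sect2.coDivSum, hterm]

/-- A flat `SU(N)` configuration is (1.9)-small on any bond set, for every `t > 0`. [cite: Balaban1985RegularSpaces, (1.9) p.77 (bookkeeping)] -/
theorem coDivSmallOn_of_flat {U : GaugeField P 0 (Node00.SU N)} (hU : ∀ p, plaqHol U p = 1) (S : Set (PBond P 0)) {t : ℝ} (ht : 0 < t) :
    Node00.Sect2.CoDivSmallOn S t U := by
  intro b _
  rw [coDivSum_of_flat hU, norm_zero]; exact ht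

/-- A flat `SU(N)` configuration lies in NODE 00's class `U_k({Ω_j}, ε₀)` on any top domain, for every `ε₀ > 0`. [cite: Balaban1985Variational, (2) p.278; Balaban1985RegularSpaces, (1.7)–(1.9) p.77] -/
theorem mem_class_of_flat {U : GaugeField P 0 (Node00.SU N)} (hU : ∀ p, plaqHol U p = 1) (Ω : ℕ → Set (Site P 0)) (Ω₀ : Set (Site P 0)) (k : ℕ) {ε₀ : ℝ}
    (hε₀ : 0 < ε₀) :
    U ∈ {U : GaugeField P 0 (Node00.SU N) | (∀ j, j ≤ k → PlaqSmallOn (Node00.Sect2.omegaPlaqsTop Ω Ω₀ j) (ε₀ * P.eta j ^ 2) U) ∧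
      Node00.Sect2.CoDivClassOnTop Ω Ω₀ k ε₀ U} := by
  have hη : ∀ j, 0 < P.eta j := fun j => pow_pos (inv_pos.mpr (Nat.cast_pos.mpr P.L_pos)) j
  exact ⟨fun j _ => plaqSmallOn_of_flat hU _ (mul_pos hε₀ (pow_pos (hη j) 2)),
    fun j _ => coDivSmallOn_of_flat hU _ (mul_pos hε₀ (pow_pos (hη j) 3))⟩

end FlatSU

/-! ## §2  Length zero: the empty (2.18) index, its empty determining set; the winding obstruction -/

section LengthZero

variable {P : Params}

/-- At length `0` the (2.2) regions of ANY sequence with `Ω 0 = ∅` are all empty (`Γ₀ = Ω₀` in the `i = k` branch). [cite: Balaban1988Convergent, (2.2) p.255 (bookkeeping, degenerate length)] -/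
theorem gammaRegion_zero_eq_empty {Ω : ℕ → Set (Site P 0)} (hΩ : Ω 0 = ∅) (i : ℕ) : gammaRegion Ω 0 i = ∅ := by
  unfold gammaRegion
  split_ifs <;> first | rfl | exact hΩ | omega

/-- At length `0` the (2.2) determining set of a sequence with `Ω 0 = ∅` has NO constrained bond at any scale. [cite: Balaban1988Convergent, (2.2) p.255 (bookkeeping, degenerate length)] -/
theorem bondsOf_genSet_zero_eq_empty {Ω : ℕ → Set (Site P 0)} (hΩ : Ω 0 = ∅) (i : ℕ) : bondsOf (genSet Ω 0 i) = ∅ := by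
  ext b
  simp [bondsOf, genSet, gammaRegion_zero_eq_empty hΩ, pts]

/-- Hence every pair of multi-scale fields agrees on it. [cite: Balaban1988Convergent, (2.11) p.256 (bookkeeping, degenerate length)] -/
theorem agreeOn_genSet_zero {G : Type*} {Ω : ℕ → Set (Site P 0)} (hΩ : Ω 0 = ∅) (V W : MSField P G) : AgreeOn (genSet Ω 0) V W := by
  intro i b hb
  rw [bondsOf_genSet_zero_eq_empty hΩ] at hb
  exact absurd hb (Set.notMem_empty b)

variable {j : ℕ}

/-- Net displacement of the straight word `(+e_μ)^n`: `n` in direction `μ`, `0` elsewhere. [folklore] -/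
private theorem netDisp_replicate (n : ℕ) (μ ν : Fin P.d) : netDisp (List.replicate n (μ, true)) ν = if μ = ν then (n : ℤ) else 0 := by
  simp only [netDisp, List.map_replicate, List.sum_replicate]
  split_ifs <;> simp

/-- The straight word `(+e_μ)^{N_j}`, `N_j` the period, spells a CLOSED walk. [folklore] -/
private theorem walkEnd_replicate_period (x : Site P j) (μ : Fin P.d) : walkEnd x (List.replicate (P.sitesPerDir j) (μ, true)) = x := by
  apply walkEnd_eq_self_of_netDisp
  intro ν
  rw [netDisp_replicate]
  split_ifs <;> simp

variable {G : Type*} [GaugeGroup G]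

/-- Along a closed walk every gauge transform of the trivial configuration has holonomy `1`. [cite: Balaban1985Averaging, (8) p.18 (bookkeeping)] -/
theorem holAt_gaugeAct_one_period (u : GaugeTransf P j G) (x : Site P j) (μ : Fin P.d) :
    T4Continuum.holAt (gaugeAct u (1 : GaugeField P j G)) (walk x (List.replicate (P.sitesPerDir j) (μ, true))) = 1 := by
  rw [holAt_gaugeAct_walk, holAt_one, walkEnd_replicate_period, mul_one, mul_inv_cancel]

/-- Along the straight walk winding ONCE around the `μ`-period the centre twist of the trivial configuration has holonomy `z` (winding law, `w = 1`). [cite: McLerranSvetitsky1981, Polyakov line (w = 1); tHooft1979Flux, §2] -/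
theorem holAt_ctwist_one_period {z : G} (hz : ∀ g : G, z * g = g * z) (x : Site P j) (μ : Fin P.d) (s : ZMod (P.sitesPerDir j)) :
    T4Continuum.holAt ((1 : GaugeField P j G).ctwist z μ s) (walk x (List.replicate (P.sitesPerDir j) (μ, true))) = z := by
  rw [holAt_ctwist_walk_of_netDisp_eq_mul hz μ s 1 x (wn := 1) (by rw [netDisp_replicate, if_pos rfl, one_mul]), holAt_one, mul_one, zpow_one]

/-- THE WINDING OBSTRUCTION: no gauge transformation carries the trivial configuration to its twist by a NON-TRIVIAL central element. [cite: tHooft1979Flux, §2] -/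
theorem gaugeAct_one_ne_ctwist {z : G} (hz : ∀ g : G, z * g = g * z) (hz1 : z ≠ 1) (u : GaugeTransf P j G) (μ : Fin P.d) (s : ZMod (P.sitesPerDir j)) :
    gaugeAct u (1 : GaugeField P j G) ≠ (1 : GaugeField P j G).ctwist z μ s := by
  intro h
  have h1 := holAt_gaugeAct_one_period u (default : Site P j) μ
  rw [h, holAt_ctwist_one_period hz] at h1
  exact hz1 h1

end LengthZero

/-! ## §3  ★★★ The closed letter `h15EUT` over all lengths is unsatisfiable -/

section Refutation

open Classical

/-- `−1 ∈ SU(2)`: a central element different from `1` exists (the centre `Z₂`). [cite: tHooft1979Flux, §2] -/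
theorem exists_central_ne_one_SU2 : ∃ z : SU2, (∀ g : SU2, z * g = g * z) ∧ z ≠ 1 := by
  have hmem : (-1 : Matrix (Fin 2) (Fin 2) ℂ) ∈ Matrix.specialUnitaryGroup (Fin 2) ℂ := by
    rw [Matrix.mem_specialUnitaryGroup_iff]
    refine ⟨?_, by simp [Matrix.det_neg, Matrix.det_one]⟩
    rw [Matrix.mem_unitaryGroup_iff]
    simp
  refine ⟨⟨-1, hmem⟩, fun g => Subtype.ext (by simp), fun h => ?_⟩
  have h00 := congrArg (fun g : SU2 => (g : Matrix (Fin 2) (Fin 2) ℂ) 0 0) h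
  norm_num at h00

/-- ★★★ **THE CLOSED EXISTENCE ∕ UNIQUENESS LETTER `h15EUT` OF `B15Prop1Thm1RowsOfExistsUnique` §3 (VERBATIM), QUANTIFIED OVER ALL LENGTHS `k' ≤ m + K`, IS FALSE** for print's numerics
(`0 < a₀`, `0 < a₁`, `0 < M₁`) on every torus whose period `M₁` divides (`side L M₁ 0 = M₁ ∣ 2L^{m+K}`): at `k' = 0` (the empty (2.18) index, empty determining set) the trivial configuration
and its centre twist are two minimisers of the unconstrained problem over the `a₀`-class that no gauge transformation relates (§2).  Print's Theorem 1 has `k ≥ 1` and is NOT touched.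
[cite: Balaban1985Variational, Thm 1 p.279, (2)–(6) p.278; Balaban1988Convergent, (2.1)–(2.2) pp.254–255, (2.12) p.256, (2.18) p.257; tHooft1979Flux, §2] -/
theorem not_thm1TorusClassEU_allLengths {F : T4Family} (ν : Node00.Stage7Numerics) (Kt : ℕ) {B₃ a₀ a₁ : ℝ} (ha₀ : 0 < a₀) (ha₁ : 0 < a₁)
    (hM : 0 < ν.M₁) (hdiv0 : side (F.P Kt).L ν.M₁ 0 ∣ (F.P Kt).sitesPerDir 0) :
    ¬ (∀ (k' : ℕ), k' ≤ (F.P Kt).m + (F.P Kt).K → side (F.P Kt).L ν.M₁ k' ∣ (F.P Kt).sitesPerDir 0 →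
      ∀ (s : B14.Eq218Concrete.Seq (fun n : ℕ => Node00.unionsOfCubes (F.P Kt) (side (F.P Kt).L ν.M₁ n)) k'),
      Node00.Sect2.SeqSeparated ν.M₁ s → 0 < ν.M₁ →
      ∀ (ε₀ : ℝ) (δ : ℕ → ℝ), (∀ j, j ≤ k' → 0 < δ j ∧ δ j ≤ a₁ ∧ B₃ * δ j ≤ ε₀) → (∀ j, j < k' → δ j ≤ 2 * δ (j + 1)) →
      (∀ j, j < k' → δ (j + 1) ≤ 2 * δ j) → ε₀ ≤ a₀ →
      ∀ W : MSField (F.P Kt) SU2,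
        Node00.Sect2.DataSmall7PTop (Node00.avOfRecord F 2 Kt) s.Ω (Node00.suppDomOfRecord F ν Kt s.Ω) k' δ W →
        (∃ U₀ : GaugeField (F.P Kt) 0 SU2, IsMinimizer (Node00.avOfRecord F 2 Kt)
            {U | (∀ j, j ≤ k' → PlaqSmallOn (Node00.Sect2.omegaPlaqsTop s.Ω (Node00.suppDomOfRecord F ν Kt s.Ω) j)
                (ε₀ * (F.P Kt).eta j ^ 2) U) ∧
              Node00.Sect2.CoDivClassOnTop s.Ω (Node00.suppDomOfRecord F ν Kt s.Ω) k' ε₀ U}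
            (genSet s.Ω k') W U₀) ∧
        ∀ U₁ U₂ : GaugeField (F.P Kt) 0 SU2,
          IsMinimizer (Node00.avOfRecord F 2 Kt)
            {U | (∀ j, j ≤ k' → PlaqSmallOn (Node00.Sect2.omegaPlaqsTop s.Ω (Node00.suppDomOfRecord F ν Kt s.Ω) j)
                (ε₀ * (F.P Kt).eta j ^ 2) U) ∧
              Node00.Sect2.CoDivClassOnTop s.Ω (Node00.suppDomOfRecord F ν Kt s.Ω) k' ε₀ U}
            (genSet s.Ω k') W U₁ →
          IsMinimizer (Node00.avOfRecord F 2 Kt)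
            {U | (∀ j, j ≤ k' → PlaqSmallOn (Node00.Sect2.omegaPlaqsTop s.Ω (Node00.suppDomOfRecord F ν Kt s.Ω) j)
                (ε₀ * (F.P Kt).eta j ^ 2) U) ∧
              Node00.Sect2.CoDivClassOnTop s.Ω (Node00.suppDomOfRecord F ν Kt s.Ω) k' ε₀ U}
            (genSet s.Ω k') W U₂ →
          ∃ u : GaugeTransf (F.P Kt) 0 SU2,
            (∀ j, j ≤ k' → ∀ b ∈ bondsOf (genSet s.Ω k' j), toMS u j b.src = toMS u j b.tgt ∧ ∀ g : SU2, toMS u j b.src * g = g * toMS u j b.src) ∧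
              gaugeAct u U₁ = U₂) := by
  intro h15EUT
  -- the empty (2.18) index of length 0
  let s : B14.Eq218Concrete.Seq (fun n : ℕ => Node00.unionsOfCubes (F.P Kt) (side (F.P Kt).L ν.M₁ n)) 0 :=
    { Ω := fun _ => ∅, Λ := fun _ => ∅,
      chain := ⟨fun j h1 h0 => by omega, fun j h1 h0 => by omega, fun j h1 h0 => by omega, fun j h1 h0 => by omega⟩,
      Ω_off := fun _ _ => rfl, Λ_off := fun _ _ => rfl }
  have hΩ0 : s.Ω 0 = ∅ := rfl
  have hsep : Node00.Sect2.SeqSeparated ν.M₁ s := fun n _ hn => absurd hn (Nat.not_lt_zero n)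
  -- print's numerics at length 0: `ε₀ := a₀`, `δ_j := min a₁ (a₀ / max B₃ 1)`
  set δ0 : ℝ := min a₁ (a₀ / max B₃ 1) with hδ0
  have hmax : 0 < max B₃ 1 := lt_of_lt_of_le one_pos (le_max_right _ _)
  have hδ0pos : 0 < δ0 := lt_min ha₁ (div_pos ha₀ hmax)
  have hBδ : B₃ * δ0 ≤ a₀ :=
    calc B₃ * δ0 ≤ max B₃ 1 * δ0 := mul_le_mul_of_nonneg_right (le_max_left _ _) hδ0pos.le
      _ ≤ max B₃ 1 * (a₀ / max B₃ 1) := mul_le_mul_of_nonneg_left (min_le_right _ _) hmax.le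
      _ = a₀ := mul_div_cancel₀ a₀ hmax.ne'
  -- the flat datum and the two flat minimisers
  obtain ⟨z, hz, hz1⟩ := exists_central_ne_one_SU2
  let μ0 : Fin (F.P Kt).d := ⟨0, (F.P Kt).hd⟩
  have hflat1 : ∀ p, plaqHol (1 : GaugeField (F.P Kt) 0 SU2) p = 1 := plaqHol_one
  have hflat2 : ∀ p, plaqHol ((1 : GaugeField (F.P Kt) 0 SU2).ctwist z μ0 0) p = 1 := plaqHol_ctwist_one hz μ0 0
  have hW : Node00.Sect2.DataSmall7PTop (Node00.avOfRecord F 2 Kt) s.Ω (Node00.suppDomOfRecord F ν Kt s.Ω) 0 (fun _ => δ0)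
      (fun j => (1 : GaugeField (F.P Kt) j SU2)) :=
    ⟨plaqSmallOn_of_flat plaqHol_one _ hδ0pos, fun m hm => absurd hm (by omega)⟩
  have h := h15EUT 0 (Nat.zero_le _) hdiv0 s hsep hM a₀ (fun _ => δ0) (fun _ _ => ⟨hδ0pos, min_le_left _ _, hBδ⟩)
    (fun j hj => absurd hj (Nat.not_lt_zero j)) (fun j hj => absurd hj (Nat.not_lt_zero j)) le_rfl _ hW
  have hmin : ∀ U : GaugeField (F.P Kt) 0 SU2, (∀ p, plaqHol U p = 1) →
      IsMinimizer (Node00.avOfRecord F 2 Kt)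
        {U | (∀ j, j ≤ 0 → PlaqSmallOn (Node00.Sect2.omegaPlaqsTop s.Ω (Node00.suppDomOfRecord F ν Kt s.Ω) j) (a₀ * (F.P Kt).eta j ^ 2) U) ∧
          Node00.Sect2.CoDivClassOnTop s.Ω (Node00.suppDomOfRecord F ν Kt s.Ω) 0 a₀ U}
        (genSet s.Ω 0) (fun j => (1 : GaugeField (F.P Kt) j SU2)) U := fun U hU =>
    ⟨mem_class_of_flat hU _ _ 0 ha₀, agreeOn_genSet_zero hΩ0 _ _, fun U' _ _ => wilsonAction4_le_of_flat hU U'⟩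
  obtain ⟨u, -, hu⟩ := h.2 _ _ (hmin _ hflat1) (hmin _ hflat2)
  exact gaugeAct_one_ne_ctwist hz hz1 u μ0 0 hu

/-- ★ **SO IS THE NODE-00 HOUSE-SHAPE TWIN `h15EU`** (the hypothesis of the parent's §4 `thm1TorusClassEU_of_thm1RecordEU`, quantified over every record index `SeqOfRecord F ν' M g K k'`
of every length): by the parent's own reduction to the torus-class letter. [cite: Balaban1985Variational, Thm 1 p.279; Balaban1988Convergent, (2.1) p.254, (2.18) p.257 (bookkeeping)] -/
theorem not_thm1RecordEU_allLengths {F : T4Family} (ν : Node00.Stage7Numerics) (Kt : ℕ) {B₃ a₀ a₁ : ℝ} (ha₀ : 0 < a₀) (ha₁ : 0 < a₁)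
    (hM : 0 < ν.M₁) (hdiv0 : side (F.P Kt).L ν.M₁ 0 ∣ (F.P Kt).sitesPerDir 0) :
    ¬ (∀ (ν' : Node00.Stage7Numerics) (M : ℕ) (g : ℕ → ℝ) (K k' : ℕ) (s : Node00.SeqOfRecord F ν' M g K k'),
      Node00.Sect2.SeqSeparated ν'.M₁ s → 0 < ν'.M₁ →
      ∀ (ε₀ : ℝ) (δ : ℕ → ℝ), (∀ j, j ≤ k' → 0 < δ j ∧ δ j ≤ a₁ ∧ B₃ * δ j ≤ ε₀) → (∀ j, j < k' → δ j ≤ 2 * δ (j + 1)) →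
      (∀ j, j < k' → δ (j + 1) ≤ 2 * δ j) → ε₀ ≤ a₀ →
      ∀ W : MSField (F.P K) SU2,
        Node00.Sect2.DataSmall7PTop (Node00.avOfRecord F 2 K) s.Ω (Node00.suppDomOfRecord F ν' K s.Ω) k' δ W →
        (∃ U₀ : GaugeField (F.P K) 0 SU2, IsMinimizer (Node00.avOfRecord F 2 K)
            {U | (∀ j, j ≤ k' → PlaqSmallOn (Node00.Sect2.omegaPlaqsTop s.Ω (Node00.suppDomOfRecord F ν' K s.Ω) j)
                (ε₀ * (F.P K).eta j ^ 2) U) ∧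
              Node00.Sect2.CoDivClassOnTop s.Ω (Node00.suppDomOfRecord F ν' K s.Ω) k' ε₀ U}
            (genSet s.Ω k') W U₀) ∧
        ∀ U₁ U₂ : GaugeField (F.P K) 0 SU2,
          IsMinimizer (Node00.avOfRecord F 2 K)
            {U | (∀ j, j ≤ k' → PlaqSmallOn (Node00.Sect2.omegaPlaqsTop s.Ω (Node00.suppDomOfRecord F ν' K s.Ω) j)
                (ε₀ * (F.P K).eta j ^ 2) U) ∧
              Node00.Sect2.CoDivClassOnTop s.Ω (Node00.suppDomOfRecord F ν' K s.Ω) k' ε₀ U}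
            (genSet s.Ω k') W U₁ →
          IsMinimizer (Node00.avOfRecord F 2 K)
            {U | (∀ j, j ≤ k' → PlaqSmallOn (Node00.Sect2.omegaPlaqsTop s.Ω (Node00.suppDomOfRecord F ν' K s.Ω) j)
                (ε₀ * (F.P K).eta j ^ 2) U) ∧
              Node00.Sect2.CoDivClassOnTop s.Ω (Node00.suppDomOfRecord F ν' K s.Ω) k' ε₀ U}
            (genSet s.Ω k') W U₂ →
          ∃ u : GaugeTransf (F.P K) 0 SU2,
            (∀ j, j ≤ k' → ∀ b ∈ bondsOf (genSet s.Ω k' j), toMS u j b.src = toMS u j b.tgt ∧ ∀ g : SU2, toMS u j b.src * g = g * toMS u j b.src) ∧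
              gaugeAct u U₁ = U₂) := fun h15EU =>
  not_thm1TorusClassEU_allLengths ν Kt ha₀ ha₁ hM hdiv0 (B15Prop1Thm1RowsOfExistsUnique.thm1TorusClassEU_of_thm1RecordEU ν Kt h15EU)

end Refutation

/-! ## §4  Convenience forms: any length's divisibility row serves; inside the parent §3's own binders the letter is contradictory -/

section AtBinders

/-- `M₁ = side L M₁ 0` divides `LᵏM₁ = side L M₁ k`. [cite: Balaban1988Convergent, (2.13) p.256 (bookkeeping)] -/
theorem side_zero_dvd_side (L M₁ k : ℕ) : side L M₁ 0 ∣ side L M₁ k := ⟨L ^ k, by unfold side; ring⟩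

/-- ★ The letter is false as soon as the divisibility row holds at ANY length `k` (as in every instance of the knit: `side L M₁ k ∣ 2L^{m+K}`). [cite: Balaban1985Variational, Thm 1 p.279; Balaban1988Convergent, (2.13) p.256, (2.18) p.257; tHooft1979Flux, §2] -/
theorem not_thm1TorusClassEU_allLengths_of_dvd {F : T4Family} (ν : Node00.Stage7Numerics) (Kt : ℕ) {B₃ a₀ a₁ : ℝ} (ha₀ : 0 < a₀) (ha₁ : 0 < a₁)
    (hM : 0 < ν.M₁) (k : ℕ) (hdiv : side (F.P Kt).L ν.M₁ k ∣ (F.P Kt).sitesPerDir 0) :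
    ¬ (∀ (k' : ℕ), k' ≤ (F.P Kt).m + (F.P Kt).K → side (F.P Kt).L ν.M₁ k' ∣ (F.P Kt).sitesPerDir 0 →
      ∀ (s : B14.Eq218Concrete.Seq (fun n : ℕ => Node00.unionsOfCubes (F.P Kt) (side (F.P Kt).L ν.M₁ n)) k'),
      Node00.Sect2.SeqSeparated ν.M₁ s → 0 < ν.M₁ →
      ∀ (ε₀ : ℝ) (δ : ℕ → ℝ), (∀ j, j ≤ k' → 0 < δ j ∧ δ j ≤ a₁ ∧ B₃ * δ j ≤ ε₀) → (∀ j, j < k' → δ j ≤ 2 * δ (j + 1)) →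
      (∀ j, j < k' → δ (j + 1) ≤ 2 * δ j) → ε₀ ≤ a₀ →
      ∀ W : MSField (F.P Kt) SU2,
        Node00.Sect2.DataSmall7PTop (Node00.avOfRecord F 2 Kt) s.Ω (Node00.suppDomOfRecord F ν Kt s.Ω) k' δ W →
        (∃ U₀ : GaugeField (F.P Kt) 0 SU2, IsMinimizer (Node00.avOfRecord F 2 Kt)
            {U | (∀ j, j ≤ k' → PlaqSmallOn (Node00.Sect2.omegaPlaqsTop s.Ω (Node00.suppDomOfRecord F ν Kt s.Ω) j)
                (ε₀ * (F.P Kt).eta j ^ 2) U) ∧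
              Node00.Sect2.CoDivClassOnTop s.Ω (Node00.suppDomOfRecord F ν Kt s.Ω) k' ε₀ U}
            (genSet s.Ω k') W U₀) ∧
        ∀ U₁ U₂ : GaugeField (F.P Kt) 0 SU2,
          IsMinimizer (Node00.avOfRecord F 2 Kt)
            {U | (∀ j, j ≤ k' → PlaqSmallOn (Node00.Sect2.omegaPlaqsTop s.Ω (Node00.suppDomOfRecord F ν Kt s.Ω) j)
                (ε₀ * (F.P Kt).eta j ^ 2) U) ∧
              Node00.Sect2.CoDivClassOnTop s.Ω (Node00.suppDomOfRecord F ν Kt s.Ω) k' ε₀ U}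
            (genSet s.Ω k') W U₁ →
          IsMinimizer (Node00.avOfRecord F 2 Kt)
            {U | (∀ j, j ≤ k' → PlaqSmallOn (Node00.Sect2.omegaPlaqsTop s.Ω (Node00.suppDomOfRecord F ν Kt s.Ω) j)
                (ε₀ * (F.P Kt).eta j ^ 2) U) ∧
              Node00.Sect2.CoDivClassOnTop s.Ω (Node00.suppDomOfRecord F ν Kt s.Ω) k' ε₀ U}
            (genSet s.Ω k') W U₂ →
          ∃ u : GaugeTransf (F.P Kt) 0 SU2,
            (∀ j, j ≤ k' → ∀ b ∈ bondsOf (genSet s.Ω k' j), toMS u j b.src = toMS u j b.tgt ∧ ∀ g : SU2, toMS u j b.src * g = g * toMS u j b.src) ∧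
              gaugeAct u U₁ = U₂) := 
  not_thm1TorusClassEU_allLengths ν Kt ha₀ ha₁ hM ((side_zero_dvd_side _ _ k).trans hdiv)

/-- ★★ **INSIDE THE PARENT §3's OWN BINDERS THE     ¬ (∀ (k' : ℕ), k' ≤ (F.P Kt).m + (F.P Kt).K → side (F.P Kt).L ν.M₁ k' ∣ (F.P Kt).sitesPerDir 0 →
      ∀ (s : B14.Eq218Concrete.Seq (fun n : ℕ => Node00.unionsOfCubes (F.P Kt) (side (F.P Kt).L ν.M₁ n)) k'),
      Node00.Sect2.SeqSeparated ν.M₁ s → 0 < ν.M₁ →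
      ∀ (ε₀ : ℝ) (δ : ℕ → ℝ), (∀ j, j ≤ k' → 0 < δ j ∧ δ j ≤ a₁ ∧ B₃ * δ j ≤ ε₀) → (∀ j, j < k' → δ j ≤ 2 * δ (j + 1)) →
      (∀ j, j < k' → δ (j + 1) ≤ 2 * δ j) → ε₀ ≤ a₀ →
      ∀ W : MSField (F.P Kt) SU2,
        Node00.Sect2.DataSmall7PTop (Node00.avOfRecord F 2 Kt) s.Ω (Node00.suppDomOfRecord F ν Kt s.Ω) k' δ W →
        (∃ U₀ : GaugeField (F.P Kt) 0 SU2, IsMinimizer (Node00.avOfRecord F 2 Kt)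
            {U | (∀ j, j ≤ k' → PlaqSmallOn (Node00.Sect2.omegaPlaqsTop s.Ω (Node00.suppDomOfRecord F ν Kt s.Ω) j)
                (ε₀ * (F.P Kt).eta j ^ 2) U) ∧
              Node00.Sect2.CoDivClassOnTop s.Ω (Node00.suppDomOfRecord F ν Kt s.Ω) k' ε₀ U}
            (genSet s.Ω k') W U₀) ∧
        ∀ U₁ U₂ : GaugeField (F.P Kt) 0 SU2,
          IsMinimizer (Node00.avOfRecord F 2 Kt)
            {U | (∀ j, j ≤ k' → PlaqSmallOn (Node00.Sect2.omegaPlaqsTop s.Ω (Node00.suppDomOfRecord F ν Kt s.Ω) j)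
                (ε₀ * (F.P Kt).eta j ^ 2) U) ∧
              Node00.Sect2.CoDivClassOnTop s.Ω (Node00.suppDomOfRecord F ν Kt s.Ω) k' ε₀ U}
            (genSet s.Ω k') W U₁ →
          IsMinimizer (Node00.avOfRecord F 2 Kt)
            {U | (∀ j, j ≤ k' → PlaqSmallOn (Node00.Sect2.omegaPlaqsTop s.Ω (Node00.suppDomOfRecord F ν Kt s.Ω) j)
                (ε₀ * (F.P Kt).eta j ^ 2) U) ∧
              Node00.Sect2.CoDivClassOnTop s.Ω (Node00.suppDomOfRecord F ν Kt s.Ω) k' ε₀ U}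
            (genSet s.Ω k') W U₂ →
          ∃ u : GaugeTransf (F.P Kt) 0 SU2,
            (∀ j, j ≤ k' → ∀ b ∈ bondsOf (genSet s.Ω k' j), toMS u j b.src = toMS u j b.tgt ∧ ∀ g : SU2, toMS u j b.src * g = g * toMS u j b.src) ∧
              gaugeAct u U₁ = U₂) IS CONTRADICTORY**: one instance of the knit (`0 < k`, `side L M₁ k ∣ 2L^{m+K}`, `2 ≤ M₁`) and the numeric rows of §3's conclusion
(`0 < ε`, `(c_E+1)ε ≤ a₁`, `B₃(c_E+1)ε ≤ εr < ε₀ ≤ a₀`, `0 ≤ c_E`) with `0 ≤ B₃` (the only inhabited regime; K0⁷'s floor is `2L² ≤ B₃`) refute `h15EUT` — so every application of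
`thm1Rows_atZ_of_thm1TorusClass_existsUnique` and of the knit heads displaying the letter verbatim is ex falso AS TYPED (A2 species; repaired by the `0 < k'` edition
`B15Prop1Thm1RowsOfExistsUniquePos`). [cite: Balaban1985Variational, Thm 1 p.279, (1)–(7) pp.277–278; Balaban1988Convergent, (2.13) p.256, (2.18) p.257; tHooft1979Flux, §2] -/
theorem not_thm1TorusClassEU_allLengths_at_binders {F : T4Family} (ν : Node00.Stage7Numerics) (Kt : ℕ) {B₃ a₀ a₁ : ℝ} (hM2 : 2 ≤ ν.M₁)
    (k : ℕ) (hdiv : side (F.P Kt).L ν.M₁ k ∣ (F.P Kt).sitesPerDir 0) {cE εr ε₀ ε : ℝ} (hcE0 : 0 ≤ cE) (hB₃ : 0 ≤ B₃) (hε : 0 < ε) (hεa₁ : (cE + 1) * ε ≤ a₁)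
    (hεr : B₃ * ((cE + 1) * ε) ≤ εr) (hr₀ : εr < ε₀) (ha₀ : ε₀ ≤ a₀) :
    ¬ (∀ (k' : ℕ), k' ≤ (F.P Kt).m + (F.P Kt).K → side (F.P Kt).L ν.M₁ k' ∣ (F.P Kt).sitesPerDir 0 →
      ∀ (s : B14.Eq218Concrete.Seq (fun n : ℕ => Node00.unionsOfCubes (F.P Kt) (side (F.P Kt).L ν.M₁ n)) k'),
      Node00.Sect2.SeqSeparated ν.M₁ s → 0 < ν.M₁ →
      ∀ (ε₀ : ℝ) (δ : ℕ → ℝ), (∀ j, j ≤ k' → 0 < δ j ∧ δ j ≤ a₁ ∧ B₃ * δ j ≤ ε₀) → (∀ j, j < k' → δ j ≤ 2 * δ (j + 1)) →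
      (∀ j, j < k' → δ (j + 1) ≤ 2 * δ j) → ε₀ ≤ a₀ →
      ∀ W : MSField (F.P Kt) SU2,
        Node00.Sect2.DataSmall7PTop (Node00.avOfRecord F 2 Kt) s.Ω (Node00.suppDomOfRecord F ν Kt s.Ω) k' δ W →
        (∃ U₀ : GaugeField (F.P Kt) 0 SU2, IsMinimizer (Node00.avOfRecord F 2 Kt)
            {U | (∀ j, j ≤ k' → PlaqSmallOn (Node00.Sect2.omegaPlaqsTop s.Ω (Node00.suppDomOfRecord F ν Kt s.Ω) j)
                (ε₀ * (F.P Kt).eta j ^ 2) U) ∧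
              Node00.Sect2.CoDivClassOnTop s.Ω (Node00.suppDomOfRecord F ν Kt s.Ω) k' ε₀ U}
            (genSet s.Ω k') W U₀) ∧
        ∀ U₁ U₂ : GaugeField (F.P Kt) 0 SU2,
          IsMinimizer (Node00.avOfRecord F 2 Kt)
            {U | (∀ j, j ≤ k' → PlaqSmallOn (Node00.Sect2.omegaPlaqsTop s.Ω (Node00.suppDomOfRecord F ν Kt s.Ω) j)
                (ε₀ * (F.P Kt).eta j ^ 2) U) ∧
              Node00.Sect2.CoDivClassOnTop s.Ω (Node00.suppDomOfRecord F ν Kt s.Ω) k' ε₀ U}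
            (genSet s.Ω k') W U₁ →
          IsMinimizer (Node00.avOfRecord F 2 Kt)
            {U | (∀ j, j ≤ k' → PlaqSmallOn (Node00.Sect2.omegaPlaqsTop s.Ω (Node00.suppDomOfRecord F ν Kt s.Ω) j)
                (ε₀ * (F.P Kt).eta j ^ 2) U) ∧
              Node00.Sect2.CoDivClassOnTop s.Ω (Node00.suppDomOfRecord F ν Kt s.Ω) k' ε₀ U}
            (genSet s.Ω k') W U₂ →
          ∃ u : GaugeTransf (F.P Kt) 0 SU2,
            (∀ j, j ≤ k' → ∀ b ∈ bondsOf (genSet s.Ω k' j), toMS u j b.src = toMS u j b.tgt ∧ ∀ g : SU2, toMS u j b.src * g = g * toMS u j b.src) ∧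
              gaugeAct u U₁ = U₂) := by
  have ha₁ : 0 < a₁ := lt_of_lt_of_le (by positivity) hεa₁
  have ha₀' : 0 < a₀ := by
    have : 0 ≤ B₃ * ((cE + 1) * ε) := by positivity
    linarith
  exact not_thm1TorusClassEU_allLengths_of_dvd ν Kt ha₀' ha₁ (by omega) k hdiv

end AtBinders

end Literature.MathematicalPhysics.QuantumFieldTheory.Balaban1983to89.B15Prop1Thm1LetterLengthZero

end
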